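import Mathlib.Algebra.DualNumber
import Mathlib.Algebra.Polynomial.Degree.Support
import Mathlib.Algebra.Algebra.Subalgebra.Basic
import Mathlib.RingTheory.Ideal.Quotient.Operations
import Mathlib.RingTheory.Polynomial.Basic
import Mathlib.RingTheory.AdjoinRoot
import Mathlib.Data.Nat.Choose.Sum
import Mathlib.Data.Nat.Prime.Factorial
import Mathlib.Tactic.FieldSimp
import Mathlib.Tactic.Ring
import Mathlib.Tactic.LinearCombination
import HarnessLib

/-!
# Deligne's example over the Witt vectors: the functor `A ↦ {a ∈ A | a^p = 0}` FAILS Schröer's divided-power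
# T¹-lifting condition ([Sch03, Ex. 3.5, second half] AS PRINTED, with [Sch03, §2]'s test algebras `W_{m,d}`)

Family `hodge` (computation cell `pub-hsemireg`, LIT-W seat «Kawamata ∕ Ran T¹-lifting as printed»), layer
`Literature/AlgebraicGeometry/Deformation`; companion of `DeligneExampleT1Lifting.lean` (the FIRST half of
[Schroeer2003T1LiftingPositiveCharacteristic, Ex. 3.5]: over a FIELD `k` of characteristic `p` the functor
«`A ↦ {a ∈ A | a^p = 0}`» has Kawamata's ∕ [FM99]'s T¹-lifting property without being smooth). This file types the
SECOND half AS PRINTED: over the Witt ring the same functor FAILS Schröer's divided-power T¹-lifting condition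
[Schroeer2003T1LiftingPositiveCharacteristic, Def. 3.2 (ii)], by print's explicit computation. Self-contained: Mathlib
only (polynomials over `ℚ`, ideals and quotients, `DualNumber`). It introduces DEFINITIONS with bodies (the divided-power
polynomial ring `ℤ⟨T⟩`, its coordinates, the test algebras `W_{m,d}`, the maps `W_{m,d+1} → W_{m,d}` and `R[ε] → S[ε]`) and
THEOREMS; no named fact, no `sorry`, no instance, no notation.

## Sources, verbatim

* [Schroeer2003T1LiftingPositiveCharacteristic] (S. Schröer, «The T¹-lifting theorem in positive characteristic»,
  J. Algebraic Geom. 12 (2003) 699–714 = arXiv:math/0102203; store text `paper:arxiv-math_0102203`, arXiv chunk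
  numbering, journal pages unseen by the cell).
  §2, p0006 L17–30 (standing hypotheses): «we assume that our discrete valuation ring `W` is of characteristic zero, and
  that its residue field `k` is of characteristic `p > 0`. Choose a uniformizer `u ∈ W`, and let `e > 0` be the absolute
  ramification index, defined by `u^e W = pW`. … the inclusion `W ⊂ W[u^{-1}]` induces a PD-structure on the subring `W`
  if and only if `e < p`. Henceforth, we shall assume this, and regard `W` as a PD-ring. This automatically holds if
  `e = 1`, that is, if `W` is its own Cohen subring.»
  §2, p0006 L33–52: «For each `m > 0`, define `W_m = W/(u^m)`, and consider the free PD-algebra in one variable `W_m⟨T⟩`.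
  Then `W_m⟨T⟩ = ⊕_{n≥0} W_m·γⁿ(T)` as abelian group. Note that `Spec(W_m⟨T⟩)` contains but one point; the ring
  `W_m⟨T⟩`, however, is nonnoetherian, because `Tⁿ = (n!)γⁿ(T)` is zero if `ord_W(n!) ≥ m`. To obtain Artin
  `W`-algebras with compatible PD-structure, we have to divide by nonnoetherian PD-ideals. Indeed,
  `(γᵈ(T), γ^{d+1}(T), γ^{d+2}(T), …) ⊂ W_m⟨T⟩`, `d ≥ 0` is such an ideal, so the quotient
  `W_{m,d} = W_m⟨T⟩/(γᵈ(T), γ^{d+1}(T), γ^{d+2}(T), …)` is a formal Artin `W`-algebra endowed with a compatible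
  PD-structure.»
  DEFINITION 3.1 (p0007 L76–81): «Let `A` be a formal Artin `W`-algebra, and `X ∈ 𝒢` an object over it. Define `T¹(X/A)` as
  the set of isomorphism classes of pairs `(Y, h)`, where `Y ∈ 𝒢` is an object over `A[ε]`, and `h : Y → X` is a
  morphism over `A[ε] → A`, `ε ↦ 0`.»
  DEFINITION 3.2 (p0007 L119–131): «We say that a semihomogeneous cofibered groupoid `π : 𝒢 → (Art/W)` has the T¹-lifting
  property if the following two conditions hold: (i) For each morphism `X → X'` over `W_{m+1} → W_m` with `m > 0`, the
  induced map `T¹(X/W_{m+1}) → T¹(X'/W_m)` is surjective. (ii) For each morphism `X → X'` over `W_{m,d} → W_{m,d−1}`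
  with `m > 0, d > 1`, the induced map `T¹(X/W_{m,d}) → T¹(X'/W_{m,d−1})` is surjective.» (p0007 L132 – p0008: «Concretely,
  this means that each diagram … over `A[ε] → A'[ε]` (`φ[ε]`), `A[ε] → A`, `A'[ε] → A'` (`ε = 0`), `A → A'` (`φ`),
  where `A → A'` is either `W_{m+1} → W_m` or `W_{m,d} → W_{m,d−1}`, can be completed …».)
  EXAMPLE 3.5 (p0009 L36–78), SECOND HALF (L51–78): «Consider the functor of Artin `W`-algebras
  `A ↦ {a ∈ A | a^p = 0}` represented by `R = W[T]/(T^p)`, and let `π : 𝒢 → (Art/W)` be the corresponding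
  semihomogeneous cofibered groupoid. … Let me check that `𝒢` also does not satisfy the T¹-lifting condition in our
  sense. For simplicity, we assume that `k` is algebraically closed and that `W` is absolutely unramified, that is,
  `e = 1`. Set `m = 2p+1`, and consider the first order extension `W_{m,p+1} → W_{m,p}`. Set `λ = p² ∈ W_m`, such that
  `pλᵖ = 0` and `p²λ^{p−1} ≠ 0`. Then `s = λγ¹(T) ∈ W_{m,p+1}` satisfies `sᵖ = 0`. Let `s' ∈ W_{m,p}` be its image.
  Then the deformation `r' = (λ+ε)γ¹(T) ∈ W_{m,p}[ε]` satisfies `(r')ᵖ = 0`. Now suppose that our groupoid `𝒢` has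
  the T¹-lifting property. Then there is an element `r ∈ W_{m,p+1}[ε]` with `rᵖ = 0` restricting to `s` and `r'`. We
  have `r = (λ+ε)γ¹(T) + xγᵖ(T)` for some `x ∈ W_m` and calculate `0 = rᵖ = p²λ^{p−1}(p−1)!·εγᵖ(T) ≠ 0`, a
  contradiction. Hence `π : 𝒢 → (Art/W)` does not satisfy the T¹-lifting condition.»
* Divided powers: [Schroeer2003T1LiftingPositiveCharacteristic, §2 p0006 L3–12] «Recall that a PD-ring is a triple
  `(R, I, γ)` … These axioms are listed in [Berthelot; Ogus 1978], Definition 3.1. They imply `(n!)γⁿ(x) = xⁿ`.»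
  (the arXiv v2 PDF prints the numeric mark «[1]»; the store text expands the cite key — [1] = Berthelot–Ogus 1978 on the
  reference list, read by eye by lit-3 g62, cell bus l.26996)
  ([BerthelotOgus1978NotesCrystalline, §3]); Mathlib has the universal divided power algebra
  (`Mathlib.RingTheory.DividedPowerAlgebra.Init`, `DividedPowerAlgebra.dp_mul : dpₙ·dpₚ = \binom{n+p}{n} dp_{n+p}`) but
  not (yet) a basis theorem for it; the concrete model below is self-contained.

## The model typed (`W = ℤ_p`) and what this file proves

* §1–§2 `ℤ⟨T⟩` (`divPowPoly : Subalgebra ℤ ℚ[X]`, the polynomials `f ∈ ℚ[T]` with `aₙ(f) := n!·coeffₙ(f) ∈ ℤ` for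
  all `n`): `dpc f n = aₙ(f)` (additive, `ℤ`-linear, `dpc_mul` = the PD product rule
  `aₙ(fg) = Σ_{i+j=n} \binom{n}{i} a_i(f) a_j(g)`), `gamma n = γⁿ(T) = Tⁿ/n!` (`dpc_gamma`, `gamma_mul_gamma` :
  `γⁱγʲ = \binom{i+j}{i}γ^{i+j}`, `gamma_one_pow` : «`Tⁿ = (n!)γⁿ(T)`»), `eq_sum_dpc_smul_gamma` :
  «`= ⊕ ℤ·γⁿ(T)`» (`f = Σ aₙ(f)·γⁿ`).
* §3 `truncIdeal p m d = (p^m, γᵈ, γ^{d+1}, …) ⊂ ℤ⟨T⟩` and `W p m d := ℤ⟨T⟩ ⧸ truncIdeal p m d` — this IS print's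
  `W_{m,d} = W_m⟨T⟩/(γᵈ(T), γ^{d+1}(T), …)` for `W = ℤ_p` (`u = p`, `e = 1`, `W_m = W/(p^m) = ℤ/p^m`, and
  `ℤ⟨T⟩ ⊗ ℤ/p^m = (ℤ/p^m)⟨T⟩`). `mem_truncIdeal_iff` : `f ∈ (p^m, γ^{≥d}) ⟺ p^m ∣ aₙ(f)` for all `n < d` — i.e.
  `W_{m,d} = ⊕_{n<d} (ℤ/p^m)·γⁿ(T)` — whence the decision procedure `zsmul_gam_eq_zero_iff` : for `n < d`,
  `c·γⁿ(T) = 0` in `W_{m,d}` iff `p^m ∣ c`; `natCast_pow_eq_zero` (`p^m = 0`), `gam_eq_zero_of_le` (`γⁿ = 0`, `n ≥ d`),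
  `gam_mul_gam`, `gam_one_pow`, and the basis statements `sum_zsmul_gam_eq_zero_iff` (the `γⁿ(T)`, `n < d`, are
  `ℤ/p^m`-independent) ∕ `exists_eq_sum_zsmul_gam` (they span): «`W_m⟨T⟩ = ⊕ W_m·γⁿ(T)`» truncated;
  `res p m d : W p m (d+1) →+* W p m d` = the restriction `W_{m,d+1} → W_{m,d}` of Def. 3.2 (ii).
* §4 `dualNumberMap φ : R[ε] →+* S[ε]` (`ε ↦ ε`) — the map `A[ε] → A'[ε]` of Def. 3.2's square.
* §4b «the functor `A ↦ {a ∈ A | a^p = 0}` represented by `R = W[T]/(T^p)`», over `ℤ` in place of `W`: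
  `exists_ringHom_adjoinRoot_iff` (a ring map `ℤ[T]/(Tᵖ) → A` with `T ↦ a` exists iff `aᵖ = 0`) and `ringHom_adjoinRoot_ext`
  (it is unique) — so the elements `s`, `r'`, `r` of §5 ARE objects of `𝒢` over the test algebras.
* §5 EXAMPLE 3.5, second half, `m = 2p + 1`, `λ = p²` (as `(p : W)²`): `p_mul_lam_pow_eq_zero` («`pλᵖ = 0`»),
  `p_sq_mul_lam_pow_ne_zero` («`p²λ^{p−1} ≠ 0`»), `s_pow_eq_zero` («`s = λγ¹(T) ∈ W_{m,p+1}` satisfies `sᵖ = 0`»),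
  `rPrime_pow_eq_zero` («`r' = (λ+ε)γ¹(T) ∈ W_{m,p}[ε]` satisfies `(r')ᵖ = 0`»), `res_s_eq_fst_rPrime` (`r'` lies
  over the image `s'` of `s`), `exists_eq_of_restrictions` («we have `r = (λ+ε)γ¹(T) + xγᵖ(T)` for some
  `x ∈ W_m`» — the shape of any `r` over `s` and `r'`, via `exists_mk_eq_zsmul_gam_of_mem`: the kernel of
  `W_{m,p+1} → W_{m,p}` is `W_m·γᵖ(T)`), and **`not_exists_lift`** («there is [no] element `r ∈ W_{m,p+1}[ε]` with `rᵖ = 0`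
  restricting to `s` and `r'`» — print's `0 = rᵖ = p²λ^{p−1}(p−1)!·εγᵖ(T) ≠ 0`): condition (ii) of Def. 3.2 FAILS for
  `𝒢 = h_R`, `R = W[T]/(T^p)`, at `(m, d) = (2p+1, p+1)`, at the object `X = s`.

HONEST SCOPE. (1) `W`: print allows any complete DVR of mixed characteristic `(0, p)` with `e < p` and, in Ex. 3.5,
assumes «for simplicity» `k = k̄` and `e = 1` (so `W = W(k̄)`); typed is `W = ℤ_p` (`k = 𝔽_p`, `e = 1`) through
`W_m = ℤ/p^m` — the computation is verbatim the printed one and uses only `e = 1` (that `p^{2p} ≠ 0` in `W_{2p+1}` and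
`(p−1)! ∈ W^×`); the case of a general absolutely unramified `W` (`W_m` flat over `ℤ/p^m`) is the same argument after
base change and is NOT typed. (2) `𝒢` ∕ `h_R`: print's object is the semihomogeneous cofibered groupoid of the functor
`A ↦ {a ∈ A | a^p = 0} = Hom_W(W[T]/(T^p), A)`; typed are its VALUES on the four algebras of the test square
(`{a ∈ A | aᵖ = 0}` for `A = W_{m,p+1}`, `W_{m,p+1}[ε]`, `W_{m,p}`, `W_{m,p}[ε]`) and the maps between them — for a
functor of sets `T¹(X/A)` of Def. 3.1 is the fibre of `F(A[ε]) → F(A)` over `X`, and the map of Def. 3.2 (ii) is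
induced by `A[ε] → A'[ε]`; `not_exists_lift` is literally «no `r` over `s` and `r'`», i.e. non-surjectivity of
`T¹(X/W_{m,p+1}) → T¹(X'/W_{m,p})` at `r'`. No cofibered-groupoid formalism, no `(Art/W)` category and no general
`T¹`-module structure ([Rim], Rmk. 1.3) is typed. (3) The divided-power STRUCTURE of `W_{m,d}` (the maps `γⁿ` on its
maximal ideal and their axioms) is not typed — only the elements `γⁿ(T)` and their multiplication table, which is all
the example uses; Mathlib's `DividedPowers` ∕ `DividedPowerAlgebra` are not invoked. (4) Condition (i) of Def. 3.2 and
Schröer's positive results (Thm. 2.1, Thm. 3.4, §4) are NOT typed. (5) `s`, `r'` are written as `(p : W)^2 * γ¹` and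
`inl ((p : W)^2 * γ¹) + inr γ¹` (no abbreviating definitions), `λ = p²` as the element `(p : W_{m,d})²` of the image of
`W_m`. (6) READING NOTE on print's displayed lift «`r = (λ+ε)γ¹(T) + xγᵖ(T)` for some `x ∈ W_m`»: since `r` restricts to
`s = λγ¹(T)` under `ε ↦ 0` and `γᵖ(T) ≠ 0` in `W_{m,p+1}`, the undetermined multiple of `γᵖ(T)` necessarily sits in the
`ε`-component — `exists_eq_of_restrictions` PROVES that every `r` over `s` and `r'` is `λγ¹(T) + (γ¹(T) + x·γᵖ(T))·ε`,
`x ∈ ℤ` (so print's `xγᵖ(T)` is read as `x·εγᵖ(T)`, `x ∈ W_m`); print's value `rᵖ = p²λ^{p−1}(p−1)!·εγᵖ(T)` is the same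
under either reading, the `x`-term contributing nothing (`gam_pred_mul_eq_zero_of_mem`). Nothing here bears on
HC ∕ HC_CM ∕ HC_AV (characteristic `0`), and no functor of any cell object is asserted
to have or to lack any lifting property; the file records, as printed, that Kawamata's T¹-lifting condition and
Schröer's PD-refinement of it DIFFER on Deligne's example.

## References

* S. Schröer, *The T¹-lifting theorem in positive characteristic*, J. Algebraic Geom. 12 (2003) 699–714
  (arXiv:math/0102203): §2 (PD-rings, `W_{m,d}`), Def. 3.1, Def. 3.2, Example 3.5.
  [Schroeer2003T1LiftingPositiveCharacteristic]
* P. Berthelot, A. Ogus, *Notes on Crystalline Cohomology*, Math. Notes 21, Princeton Univ. Press 1978: §3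
  (divided powers; Def. 3.1). [BerthelotOgus1978NotesCrystalline]
* Y. Kawamata, *Unobstructed deformations — a remark on a paper of Z. Ran*, J. Algebraic Geom. 1 (1992) 183–190
  (Deligne's example over `k`, as reported by Schröer; not held). [Kawamata1992UnobstructedDeformations]
-/

noncomputable section

namespace Literature.AlgebraicGeometry.Deformation

open Polynomial Finset

namespace Schroeer2003

/-! ### §1 The divided-power polynomial ring `ℤ⟨T⟩ ⊂ ℚ[T]` and its coordinates `aₙ(f) = n!·coeffₙ(f) ∈ ℤ` -/

/-- `\binom{i+j}{i}·i!·j! = (i+j)!` in `ℚ`. [cite: Schroeer2003T1LiftingPositiveCharacteristic, §2 (arXiv p0006 L6–12)] -/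
theorem choose_mul_factorial_mul_factorial_cast (i j : ℕ) :
    (((i + j).choose i : ℕ) : ℚ) * (i.factorial : ℚ) * (j.factorial : ℚ) = ((i + j).factorial : ℚ) := by
  rw [Nat.choose_symm_add]; exact_mod_cast Nat.add_choose_mul_factorial_mul_factorial i j

/-- THE FREE DIVIDED-POWER ALGEBRA IN ONE VARIABLE OVER `ℤ`, `ℤ⟨T⟩ = ⊕_{n ≥ 0} ℤ·γⁿ(T)`, `γⁿ(T) = Tⁿ/n!`
([Schroeer2003T1LiftingPositiveCharacteristic, §2 p0006 L33–37]: «consider the free PD-algebra in one variable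
`W_m⟨T⟩`. Then `W_m⟨T⟩ = ⊕_{n≥0} W_m·γⁿ(T)` as abelian group»; [BerthelotOgus1978NotesCrystalline, §3] for divided powers), realised
inside `ℚ[T]` as the subring of polynomials `f` with `n!·coeffₙ(f) ∈ ℤ` for every `n` (closed under products because
`n!·a_i b_j = \binom{n}{i}·(i! a_i)(j! b_j)` for `i + j = n`). Base-changed to `W_m = ℤ/p^m` below.
[cite: Schroeer2003T1LiftingPositiveCharacteristic, §2 (arXiv p0006 L33–37)] -/
def divPowPoly : Subalgebra ℤ ℚ[X] where
  carrier := {f | ∀ n : ℕ, ∃ a : ℤ, (a : ℚ) = (n.factorial : ℚ) * f.coeff n}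
  mul_mem' {f g} hf hg n := by
    choose a ha using hf
    choose b hb using hg
    refine ⟨∑ ij ∈ antidiagonal n, (n.choose ij.1 : ℤ) * a ij.1 * b ij.2, ?_⟩
    rw [coeff_mul, mul_sum]
    push_cast
    refine sum_congr rfl fun ij hij => ?_
    rw [mem_antidiagonal] at hij
    rw [ha, hb]
    have h : ((n.choose ij.1 : ℕ) : ℚ) * (ij.1.factorial : ℚ) * (ij.2.factorial : ℚ) = (n.factorial : ℚ) := by
      rw [← hij]; exact choose_mul_factorial_mul_factorial_cast ij.1 ij.2
    rw [← h]
    ring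
  add_mem' {f g} hf hg n := by
    obtain ⟨a, ha⟩ := hf n
    obtain ⟨b, hb⟩ := hg n
    exact ⟨a + b, by rw [Int.cast_add, ha, hb, coeff_add, mul_add]⟩
  algebraMap_mem' r n := ⟨if n = 0 then r else 0, by
    rw [eq_intCast, ← C_eq_intCast, coeff_C]
    split_ifs with h
    · subst h; rw [Nat.factorial_zero, Nat.cast_one, one_mul]
    · rw [Int.cast_zero, mul_zero]⟩

/-- Membership in `ℤ⟨T⟩`: all `n!·coeffₙ` are integers. [cite: Schroeer2003T1LiftingPositiveCharacteristic, §2 (arXiv p0006 L33–37)] -/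
theorem mem_divPowPoly_iff (f : ℚ[X]) :
    f ∈ divPowPoly ↔ ∀ n : ℕ, ∃ a : ℤ, (a : ℚ) = (n.factorial : ℚ) * f.coeff n := Iff.rfl

/-- The `γⁿ`-coordinate `aₙ(f) := n!·coeffₙ(f) ∈ ℤ` of `f ∈ ℤ⟨T⟩`.
[cite: Schroeer2003T1LiftingPositiveCharacteristic, §2 (arXiv p0006 L33–37)] -/
def dpc (f : divPowPoly) (n : ℕ) : ℤ := (f.2 n).choose

/-- Defining property of `aₙ(f)`. [cite: Schroeer2003T1LiftingPositiveCharacteristic, §2 (arXiv p0006 L33–37)] -/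
theorem dpc_spec (f : divPowPoly) (n : ℕ) : (dpc f n : ℚ) = (n.factorial : ℚ) * (f : ℚ[X]).coeff n :=
  (f.2 n).choose_spec

/-- `aₙ` is characterised by its defining property. [cite: Schroeer2003T1LiftingPositiveCharacteristic, §2 (arXiv p0006 L33–37)] -/
theorem dpc_eq_of_eq (f : divPowPoly) (n : ℕ) (a : ℤ) (h : (a : ℚ) = (n.factorial : ℚ) * (f : ℚ[X]).coeff n) :
    dpc f n = a :=
  Int.cast_injective (α := ℚ) (by rw [dpc_spec, h])

/-- `aₙ(0) = 0`. [cite: Schroeer2003T1LiftingPositiveCharacteristic, §2 (arXiv p0006 L33–37)] -/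
theorem dpc_zero (n : ℕ) : dpc 0 n = 0 :=
  dpc_eq_of_eq _ _ _ (by rw [Int.cast_zero, ZeroMemClass.coe_zero, coeff_zero, mul_zero])

/-- `aₙ(f + g) = aₙ(f) + aₙ(g)`. [cite: Schroeer2003T1LiftingPositiveCharacteristic, §2 (arXiv p0006 L33–37)] -/
theorem dpc_add (f g : divPowPoly) (n : ℕ) : dpc (f + g) n = dpc f n + dpc g n :=
  dpc_eq_of_eq _ _ _ (by rw [Int.cast_add, dpc_spec, dpc_spec, AddMemClass.coe_add, coeff_add, mul_add])

/-- `aₙ(c·f) = c·aₙ(f)` (`c ∈ ℤ`). [cite: Schroeer2003T1LiftingPositiveCharacteristic, §2 (arXiv p0006 L33–37)] -/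
theorem dpc_zsmul (c : ℤ) (f : divPowPoly) (n : ℕ) : dpc (c • f) n = c * dpc f n :=
  dpc_eq_of_eq _ _ _ (by rw [Int.cast_mul, dpc_spec, SetLike.val_smul, coeff_smul, zsmul_eq_mul]; ring)

/-- THE DIVIDED-POWER PRODUCT RULE in coordinates: `aₙ(fg) = Σ_{i+j=n} \binom{n}{i} a_i(f) a_j(g)` — i.e.
`γⁱ·γʲ = \binom{i+j}{i} γ^{i+j}` ([BerthelotOgus1978NotesCrystalline, Def. 3.1]).
[cite: Schroeer2003T1LiftingPositiveCharacteristic, §2 (arXiv p0006 L6–12)] -/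
theorem dpc_mul (f g : divPowPoly) (n : ℕ) :
    dpc (f * g) n = ∑ ij ∈ antidiagonal n, (n.choose ij.1 : ℤ) * dpc f ij.1 * dpc g ij.2 := by
  apply dpc_eq_of_eq
  rw [MulMemClass.coe_mul, coeff_mul, mul_sum]
  push_cast
  refine sum_congr rfl fun ij hij => ?_
  rw [mem_antidiagonal] at hij
  rw [dpc_spec, dpc_spec]
  have h : ((n.choose ij.1 : ℕ) : ℚ) * (ij.1.factorial : ℚ) * (ij.2.factorial : ℚ) = (n.factorial : ℚ) := by
    rw [← hij]; exact choose_mul_factorial_mul_factorial_cast ij.1 ij.2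
  rw [← h]
  ring

/-- `aₙ(c) = c·[n = 0]` for an integer constant `c`. [cite: Schroeer2003T1LiftingPositiveCharacteristic, §2 (arXiv p0006 L33–37)] -/
theorem dpc_natCast (c n : ℕ) : dpc (c : divPowPoly) n = if n = 0 then (c : ℤ) else 0 := by
  apply dpc_eq_of_eq
  rw [show ((c : divPowPoly) : ℚ[X]) = C (c : ℚ) by rw [map_natCast]; rfl, coeff_C]
  split_ifs with h
  · subst h; rw [Nat.factorial_zero, Nat.cast_one, one_mul, Int.cast_natCast]
  · rw [Int.cast_zero, mul_zero]

/-! ### §2 The divided powers `γⁿ(T) = Tⁿ/n!` -/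

/-- `γⁿ(T) = Tⁿ/n! ∈ ℤ⟨T⟩`. [cite: Schroeer2003T1LiftingPositiveCharacteristic, §2 (arXiv p0006 L33–37)] -/
def gamma (n : ℕ) : divPowPoly :=
  ⟨C ((n.factorial : ℚ)⁻¹) * X ^ n, fun k => ⟨if k = n then 1 else 0, by
    rw [coeff_C_mul_X_pow]
    split_ifs with h
    · subst h; rw [Int.cast_one, mul_inv_cancel₀ (Nat.cast_ne_zero.2 (Nat.factorial_ne_zero _))]
    · rw [Int.cast_zero, mul_zero]⟩⟩

/-- `γⁿ(T) = Tⁿ/n!` as a rational polynomial. [cite: Schroeer2003T1LiftingPositiveCharacteristic, §2 (arXiv p0006 L33–37)] -/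
theorem coe_gamma (n : ℕ) : (gamma n : ℚ[X]) = C ((n.factorial : ℚ)⁻¹) * X ^ n := rfl

/-- Coordinates of `γⁿ(T)`: `a_k(γⁿ) = [k = n]`. [cite: Schroeer2003T1LiftingPositiveCharacteristic, §2 (arXiv p0006 L33–37)] -/
theorem dpc_gamma (n k : ℕ) : dpc (gamma n) k = if k = n then 1 else 0 := by
  apply dpc_eq_of_eq
  rw [coe_gamma, coeff_C_mul_X_pow]
  split_ifs with h
  · subst h; rw [Int.cast_one, mul_inv_cancel₀ (Nat.cast_ne_zero.2 (Nat.factorial_ne_zero _))]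
  · rw [Int.cast_zero, mul_zero]

/-- `γ¹(T) = T`. [cite: Schroeer2003T1LiftingPositiveCharacteristic, Ex. 3.5] -/
theorem coe_gamma_one : (gamma 1 : ℚ[X]) = X := by
  rw [coe_gamma, Nat.factorial_one, Nat.cast_one, inv_one, C_1, one_mul, pow_one]

/-- THE DIVIDED-POWER PRODUCT RULE `γⁱ(T)·γʲ(T) = \binom{i+j}{i}·γ^{i+j}(T)` ([BerthelotOgus1978NotesCrystalline, Def. 3.1]).
[cite: Schroeer2003T1LiftingPositiveCharacteristic, §2 (arXiv p0006 L6–12 and L31–35)] -/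
theorem gamma_mul_gamma (i j : ℕ) : gamma i * gamma j = ((i + j).choose i : ℤ) • gamma (i + j) := by
  apply Subtype.ext
  rw [MulMemClass.coe_mul, SetLike.val_smul, coe_gamma, coe_gamma, coe_gamma, zsmul_eq_mul, Int.cast_natCast,
    ← C_eq_natCast]
  have hi : (i.factorial : ℚ) ≠ 0 := Nat.cast_ne_zero.2 (Nat.factorial_ne_zero _)
  have hj : (j.factorial : ℚ) ≠ 0 := Nat.cast_ne_zero.2 (Nat.factorial_ne_zero _)
  have hc : (((i + j).choose i : ℕ) : ℚ) ≠ 0 := by exact_mod_cast (Nat.choose_pos (Nat.le_add_right i j)).ne'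
  have h := choose_mul_factorial_mul_factorial_cast i j
  calc C ((i.factorial : ℚ)⁻¹) * X ^ i * (C ((j.factorial : ℚ)⁻¹) * X ^ j)
      = C ((i.factorial : ℚ)⁻¹ * (j.factorial : ℚ)⁻¹) * X ^ (i + j) := by
        rw [mul_mul_mul_comm, ← C_mul, ← pow_add]
    _ = C ((((i + j).choose i : ℕ) : ℚ) * ((i + j).factorial : ℚ)⁻¹) * X ^ (i + j) := by
        congr 2
        rw [← h]
        field_simp
    _ = C (((i + j).choose i : ℕ) : ℚ) * (C (((i + j).factorial : ℚ)⁻¹) * X ^ (i + j)) := by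
        rw [C_mul, mul_assoc]

/-- «`Tⁿ = (n!)γⁿ(T)`» ([Schroeer2003T1LiftingPositiveCharacteristic, §2 p0006 L37–38]).
[cite: Schroeer2003T1LiftingPositiveCharacteristic, §2 (arXiv p0006 L37–38)] -/
theorem gamma_one_pow (n : ℕ) : gamma 1 ^ n = (n.factorial : ℤ) • gamma n := by
  apply Subtype.ext
  rw [SubmonoidClass.coe_pow, coe_gamma_one, SetLike.val_smul, coe_gamma, zsmul_eq_mul, Int.cast_natCast,
    ← C_eq_natCast, ← mul_assoc, ← C_mul, mul_inv_cancel₀ (Nat.cast_ne_zero.2 (Nat.factorial_ne_zero _)), C_1,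
    one_mul]

/-- `ℤ⟨T⟩ = ⊕ ℤ·γⁿ(T)`: every `f ∈ ℤ⟨T⟩` is the finite sum `Σ aₙ(f)·γⁿ(T)`.
[cite: Schroeer2003T1LiftingPositiveCharacteristic, §2 (arXiv p0006 L33–37)] -/
theorem eq_sum_dpc_smul_gamma (f : divPowPoly) : f = ∑ n ∈ (f : ℚ[X]).support, dpc f n • gamma n := by
  apply Subtype.ext
  change divPowPoly.val f = divPowPoly.val _
  rw [map_sum]
  conv_lhs => rw [Subalgebra.val_apply, (f : ℚ[X]).as_sum_support]
  refine sum_congr rfl fun n _ => ?_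
  rw [map_zsmul, Subalgebra.val_apply, coe_gamma, zsmul_eq_mul, ← C_eq_intCast, ← mul_assoc, ← C_mul, dpc_spec,
    mul_comm (n.factorial : ℚ) ((f : ℚ[X]).coeff n), mul_assoc,
    mul_inv_cancel₀ (Nat.cast_ne_zero.2 (Nat.factorial_ne_zero _)), mul_one, C_mul_X_pow_eq_monomial]

/-! ### §3 The test algebras `W_{m,d} = W_m⟨T⟩/(γᵈ(T), γ^{d+1}(T), …)`, `W_m = W/(u^m)`, for `W = ℤ_p` (`u = p`, `e = 1`) -/

/-- The ideal `(u^m, γᵈ(T), γ^{d+1}(T), γ^{d+2}(T), …) ⊂ ℤ⟨T⟩` for `u = p`: so that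
`ℤ⟨T⟩/(p^m, γᵈ, γ^{d+1}, …) = W_m⟨T⟩/(γᵈ(T), γ^{d+1}(T), …) = W_{m,d}` for `W = ℤ_p`, `W_m = W/(p^m) = ℤ/p^m`
([Schroeer2003T1LiftingPositiveCharacteristic, §2 p0006 L45–52]: «`W_{m,d} = W_m⟨T⟩/(γᵈ(T), γ^{d+1}(T), γ^{d+2}(T), …)`
is a formal Artin `W`-algebra endowed with a compatible PD-structure»).
[cite: Schroeer2003T1LiftingPositiveCharacteristic, §2 (arXiv p0006 L45–52)] -/
def truncIdeal (p m d : ℕ) : Ideal divPowPoly :=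
  Ideal.span (insert ((p : divPowPoly) ^ m) (gamma '' Set.Ici d))

/-- `p^m ∈ (p^m, γ^{≥ d})`. [cite: Schroeer2003T1LiftingPositiveCharacteristic, §2 (arXiv p0006 L45–52)] -/
theorem pow_mem_truncIdeal (p m d : ℕ) : (p : divPowPoly) ^ m ∈ truncIdeal p m d :=
  Ideal.subset_span (Set.mem_insert _ _)

/-- `γⁿ(T) ∈ (p^m, γ^{≥ d})` for `n ≥ d`. [cite: Schroeer2003T1LiftingPositiveCharacteristic, §2 (arXiv p0006 L45–52)] -/
theorem gamma_mem_truncIdeal (p m : ℕ) {d n : ℕ} (hn : d ≤ n) : gamma n ∈ truncIdeal p m d :=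
  Ideal.subset_span (Set.mem_insert_of_mem _ ⟨n, hn, rfl⟩)

/-- `(p^m, γ^{≥ d'}) ⊆ (p^m, γ^{≥ d})` for `d ≤ d'` (the restriction `W_{m,d'} → W_{m,d}`).
[cite: Schroeer2003T1LiftingPositiveCharacteristic, Def. 3.2 (ii)] -/
theorem truncIdeal_anti (p m : ℕ) {d d' : ℕ} (h : d ≤ d') : truncIdeal p m d' ≤ truncIdeal p m d := by
  refine Ideal.span_le.2 (Set.insert_subset (pow_mem_truncIdeal p m d) ?_)
  rintro _ ⟨n, hn, rfl⟩
  exact gamma_mem_truncIdeal p m (le_trans h hn)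

/-- The coordinate description, one inclusion: the set of `f ∈ ℤ⟨T⟩` with `p^m ∣ aₙ(f)` for all `n < d` is an
ideal (by the divided-power product rule). [cite: Schroeer2003T1LiftingPositiveCharacteristic, §2 (arXiv p0006 L33–52)] -/
def dvdIdeal (p m d : ℕ) : Ideal divPowPoly where
  carrier := {f | ∀ n < d, (p : ℤ) ^ m ∣ dpc f n}
  zero_mem' n _ := by rw [dpc_zero]; exact dvd_zero _
  add_mem' hf hg n hn := by rw [dpc_add]; exact dvd_add (hf n hn) (hg n hn)
  smul_mem' g f hf n hn := by
    rw [smul_eq_mul, dpc_mul]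
    refine dvd_sum fun ij hij => ?_
    rw [mem_antidiagonal] at hij
    exact Dvd.dvd.mul_left (hf ij.2 (by omega)) _

/-- Membership in `dvdIdeal`. [cite: Schroeer2003T1LiftingPositiveCharacteristic, §2 (arXiv p0006 L33–52)] -/
theorem mem_dvdIdeal_iff (p m d : ℕ) (f : divPowPoly) :
    f ∈ dvdIdeal p m d ↔ ∀ n < d, (p : ℤ) ^ m ∣ dpc f n := Iff.rfl

/-- `W_{m,d} = ⊕_{n<d} W_m·γⁿ(T)` in coordinates: `f ∈ (p^m, γ^{≥ d})` iff `p^m ∣ aₙ(f)` for every `n < d`.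
[cite: Schroeer2003T1LiftingPositiveCharacteristic, §2 (arXiv p0006 L33–52)] -/
theorem mem_truncIdeal_iff (p m d : ℕ) (f : divPowPoly) :
    f ∈ truncIdeal p m d ↔ ∀ n < d, (p : ℤ) ^ m ∣ dpc f n := by
  constructor
  · intro hf
    have hle : truncIdeal p m d ≤ dvdIdeal p m d := by
      refine Ideal.span_le.2 (Set.insert_subset ?_ ?_)
      · intro n _
        rw [show ((p : divPowPoly) ^ m) = ((p ^ m : ℕ) : divPowPoly) from (Nat.cast_pow p m).symm, dpc_natCast]
        split_ifs
        · exact ⟨1, by push_cast; ring⟩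
        · exact dvd_zero _
      · rintro _ ⟨n', hn', rfl⟩ n hn
        rw [dpc_gamma, if_neg (by rintro rfl; exact absurd hn' (not_le.2 hn))]
        exact dvd_zero _
    exact hle hf
  · intro h
    rw [eq_sum_dpc_smul_gamma f]
    refine Submodule.sum_mem _ fun n _ => ?_
    by_cases hn : n < d
    · obtain ⟨b, hb⟩ := h n hn
      rw [hb, mul_comm, ← smul_smul]
      refine zsmul_mem ?_ b
      rw [zsmul_eq_mul, Int.cast_pow, Int.cast_natCast]
      exact Ideal.mul_mem_right _ _ (pow_mem_truncIdeal p m d)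
    · rw [zsmul_eq_mul]
      exact Ideal.mul_mem_left _ _ (gamma_mem_truncIdeal p m (not_lt.1 hn))

/-- `W_{m,d}` for `W = ℤ_p`: the quotient `ℤ⟨T⟩/(p^m, γᵈ(T), γ^{d+1}(T), …) = (ℤ/p^m)⟨T⟩/(γ^{≥d})`.
[cite: Schroeer2003T1LiftingPositiveCharacteristic, §2 (arXiv p0006 L45–52)] -/
abbrev W (p m d : ℕ) : Type := divPowPoly ⧸ truncIdeal p m d

/-- `γⁿ(T) ∈ W_{m,d}`. [cite: Schroeer2003T1LiftingPositiveCharacteristic, §2 (arXiv p0006 L45–52)] -/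
def gam (p m d n : ℕ) : W p m d := Ideal.Quotient.mk (truncIdeal p m d) (gamma n)

/-- `γⁿ(T) = 0` in `W_{m,d}` for `n ≥ d`. [cite: Schroeer2003T1LiftingPositiveCharacteristic, §2 (arXiv p0006 L45–52)] -/
theorem gam_eq_zero_of_le {p m d n : ℕ} (hn : d ≤ n) : gam p m d n = 0 :=
  Ideal.Quotient.eq_zero_iff_mem.2 (gamma_mem_truncIdeal p m hn)

/-- `u^m = p^m = 0` in `W_{m,d}` (`W_m = W/(u^m)`). [cite: Schroeer2003T1LiftingPositiveCharacteristic, §2 (arXiv p0006 L33)] -/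
theorem natCast_pow_eq_zero (p m d : ℕ) : ((p : W p m d)) ^ m = 0 := by
  rw [← map_natCast (Ideal.Quotient.mk (truncIdeal p m d)), ← map_pow, Ideal.Quotient.eq_zero_iff_mem]
  exact pow_mem_truncIdeal p m d

/-- The product rule in `W_{m,d}`: `γⁱ·γʲ = \binom{i+j}{i} γ^{i+j}`. [cite: Schroeer2003T1LiftingPositiveCharacteristic, §2 (arXiv p0006 L6–12)] -/
theorem gam_mul_gam (p m d i j : ℕ) : gam p m d i * gam p m d j = ((i + j).choose i : ℤ) • gam p m d (i + j) := by
  rw [gam, gam, gam, ← map_mul, gamma_mul_gamma, map_zsmul]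

/-- `Tⁿ = n!·γⁿ(T)` in `W_{m,d}` (`T = γ¹(T)`). [cite: Schroeer2003T1LiftingPositiveCharacteristic, §2 (arXiv p0006 L37–38)] -/
theorem gam_one_pow (p m d n : ℕ) : gam p m d 1 ^ n = (n.factorial : ℤ) • gam p m d n := by
  rw [gam, gam, ← map_pow, gamma_one_pow, map_zsmul]

/-- THE COORDINATE CRITERION in `W_{m,d}`: for `n < d` and `c ∈ ℤ`, `c·γⁿ(T) = 0` in `W_{m,d}` iff `p^m ∣ c`
(`W_{m,d}` is free over `W_m = ℤ/p^m` on `γ⁰, …, γ^{d−1}`).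
[cite: Schroeer2003T1LiftingPositiveCharacteristic, §2 (arXiv p0006 L33–52)] -/
theorem zsmul_gam_eq_zero_iff {p m d n : ℕ} (hn : n < d) (c : ℤ) : c • gam p m d n = 0 ↔ (p : ℤ) ^ m ∣ c := by
  rw [gam, ← map_zsmul, Ideal.Quotient.eq_zero_iff_mem, mem_truncIdeal_iff]
  constructor
  · intro h
    have h' := h n hn
    rwa [dpc_zsmul, dpc_gamma, if_pos rfl, mul_one] at h'
  · intro h k _
    rw [dpc_zsmul, dpc_gamma]
    split_ifs
    · rwa [mul_one]
    · rw [mul_zero]; exact dvd_zero _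

/-- `aₙ` of a finite sum. [cite: Schroeer2003T1LiftingPositiveCharacteristic, §2 (arXiv p0006 L33–37)] -/
theorem dpc_sum {ι : Type*} (t : Finset ι) (f : ι → divPowPoly) (n : ℕ) :
    dpc (∑ i ∈ t, f i) n = ∑ i ∈ t, dpc (f i) n := by
  classical
  induction t using Finset.induction_on with
  | empty => rw [sum_empty, sum_empty, dpc_zero]
  | insert a t ha ih => rw [sum_insert ha, sum_insert ha, dpc_add, ih]

/-- «`W_m⟨T⟩ = ⊕_{n ≥ 0} W_m·γⁿ(T)` as abelian group», truncated: in `W_{m,d}` a combination `Σ_{n<d} cₙ·γⁿ(T)`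
(`cₙ ∈ ℤ`) vanishes iff every `cₙ` vanishes in `W_m = ℤ/p^m` — the `γⁿ(T)`, `n < d`, are `W_m`-linearly independent.
[cite: Schroeer2003T1LiftingPositiveCharacteristic, §2 (arXiv p0006 L33–52)] -/
theorem sum_zsmul_gam_eq_zero_iff (p m d : ℕ) (c : ℕ → ℤ) :
    ∑ n ∈ range d, c n • gam p m d n = 0 ↔ ∀ n < d, (p : ℤ) ^ m ∣ c n := by
  have hsum : ∑ n ∈ range d, c n • gam p m d n =
      Ideal.Quotient.mk (truncIdeal p m d) (∑ n ∈ range d, c n • gamma n) := by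
    rw [map_sum]
    exact sum_congr rfl fun n _ => by rw [map_zsmul, gam]
  have hdpc : ∀ n < d, dpc (∑ i ∈ range d, c i • gamma i) n = c n := by
    intro n hn
    rw [dpc_sum, sum_eq_single n]
    · rw [dpc_zsmul, dpc_gamma, if_pos rfl, mul_one]
    · intro i _ hi
      rw [dpc_zsmul, dpc_gamma, if_neg (Ne.symm hi), mul_zero]
    · intro h
      exact absurd (mem_range.2 hn) h
  rw [hsum, Ideal.Quotient.eq_zero_iff_mem, mem_truncIdeal_iff]
  exact ⟨fun h n hn => hdpc n hn ▸ h n hn, fun h n hn => (hdpc n hn).symm ▸ h n hn⟩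

/-- «`W_m⟨T⟩ = ⊕_{n ≥ 0} W_m·γⁿ(T)`», truncated: every element of `W_{m,d}` is a combination `Σ_{n<d} cₙ·γⁿ(T)` with
`cₙ ∈ ℤ` (so, with `sum_zsmul_gam_eq_zero_iff` and `natCast_pow_eq_zero`: `W_{m,d} = ⊕_{n<d} (ℤ/p^m)·γⁿ(T)`).
[cite: Schroeer2003T1LiftingPositiveCharacteristic, §2 (arXiv p0006 L33–52)] -/
theorem exists_eq_sum_zsmul_gam (p m d : ℕ) (x : W p m d) :
    ∃ c : ℕ → ℤ, x = ∑ n ∈ range d, c n • gam p m d n := by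
  obtain ⟨f, rfl⟩ := Ideal.Quotient.mk_surjective x
  refine ⟨dpc f, ?_⟩
  -- `f = Σ_{n ∈ supp f} aₙ(f) γⁿ`; modulo `(p^m, γ^{≥ d})` only `n < d` survive, and `aₙ(f) = 0` off the support
  have hf : Ideal.Quotient.mk (truncIdeal p m d) f =
      ∑ n ∈ (f : ℚ[X]).support, dpc f n • gam p m d n := by
    conv_lhs => rw [eq_sum_dpc_smul_gamma f]
    rw [map_sum]
    exact sum_congr rfl fun n _ => by rw [map_zsmul, gam]
  rw [hf]
  classical
  -- both sums equal the sum over `supp ∪ range d` of the same summand, which vanishes off each of the two sets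
  have h0 : ∀ n, n ∉ (f : ℚ[X]).support → dpc f n • gam p m d n = 0 := by
    intro n hn
    rw [Polynomial.notMem_support_iff] at hn
    rw [dpc_eq_of_eq f n 0 (by rw [hn, mul_zero, Int.cast_zero]), zero_smul]
  have h1 : ∀ n, n ∉ range d → dpc f n • gam p m d n = 0 := by
    intro n hn
    rw [gam_eq_zero_of_le (not_lt.1 fun h => hn (mem_range.2 h))]
    exact smul_zero _
  rw [sum_subset (subset_union_left (s₂ := range d)) fun n _ hn => h0 n hn,
    sum_subset (subset_union_right (s₁ := (f : ℚ[X]).support)) fun n _ hn => h1 n hn]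

/-- The restriction map `W_{m,d+1} → W_{m,d}` (`γᵈ(T) ↦ 0`), along which [Schroeer2003T1LiftingPositiveCharacteristic,
Def. 3.2 (ii)] asks `T¹` to be surjective. [cite: Schroeer2003T1LiftingPositiveCharacteristic, Def. 3.2 (ii)] -/
def res (p m d : ℕ) : W p m (d + 1) →+* W p m d :=
  Ideal.Quotient.factor (truncIdeal_anti p m (Nat.le_succ d))

/-- `res (γⁿ) = γⁿ`. [cite: Schroeer2003T1LiftingPositiveCharacteristic, Def. 3.2 (ii)] -/
theorem res_gam (p m d n : ℕ) : res p m d (gam p m (d + 1) n) = gam p m d n :=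
  Ideal.Quotient.factor_mk _ _

/-! ### §4 `A[ε]` functorially: the map `W_{m,d+1}[ε] → W_{m,d}[ε]` -/

/-- `φ[ε] : R[ε] → S[ε]` for a ring map `φ : R → S` (`ε ↦ ε`).
[cite: Schroeer2003T1LiftingPositiveCharacteristic, Def. 3.2 («over A[ε] → A'[ε]»)] -/
def dualNumberMap {R S : Type*} [CommRing R] [CommRing S] (φ : R →+* S) : DualNumber R →+* DualNumber S where
  toFun r := TrivSqZeroExt.inl (φ r.fst) + TrivSqZeroExt.inr (φ r.snd)
  map_one' := by ext <;> simp
  map_mul' x y := by ext <;> simp [TrivSqZeroExt.snd_mul]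
  map_zero' := by ext <;> simp
  map_add' x y := by ext <;> simp

/-- `fst ∘ φ[ε] = φ ∘ fst`. [cite: Schroeer2003T1LiftingPositiveCharacteristic, Def. 3.2] -/
@[simp] theorem fst_dualNumberMap {R S : Type*} [CommRing R] [CommRing S] (φ : R →+* S) (r : DualNumber R) :
    (dualNumberMap φ r).fst = φ r.fst := by
  simp [dualNumberMap]

/-- `snd ∘ φ[ε] = φ ∘ snd`. [cite: Schroeer2003T1LiftingPositiveCharacteristic, Def. 3.2] -/
@[simp] theorem snd_dualNumberMap {R S : Type*} [CommRing R] [CommRing S] (φ : R →+* S) (r : DualNumber R) :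
    (dualNumberMap φ r).snd = φ r.snd := by
  simp [dualNumberMap]

/-! ### §4b The functor «`A ↦ {a ∈ A | aᵖ = 0}` represented by `R = W[T]/(Tᵖ)`», over `ℤ` in place of `W` -/

/-- Points of `ℤ[T]/(Tᵖ)` are determined by the image of `T` (so `W`-points of `W[T]/(Tᵖ) = W ⊗ ℤ[T]/(Tᵖ)` too).
[cite: Schroeer2003T1LiftingPositiveCharacteristic, Ex. 3.5 (arXiv p0009 L36–39)] -/
theorem ringHom_adjoinRoot_ext {A : Type*} [CommRing A] {p : ℕ} {φ ψ : AdjoinRoot ((X : ℤ[X]) ^ p) →+* A}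
    (h : φ (AdjoinRoot.root _) = ψ (AdjoinRoot.root _)) : φ = ψ := by
  have hφψ : φ.toIntAlgHom = ψ.toIntAlgHom := AdjoinRoot.algHom_ext h
  exact RingHom.ext fun x => AlgHom.congr_fun hφψ x

/-- «Consider the functor of Artin `W`-algebras `A ↦ {a ∈ A | a^p = 0}` represented by `R = W[T]/(T^p)`»: over `ℤ`
in place of `W` (a `W`-algebra map `W[T]/(Tᵖ) = W ⊗_ℤ ℤ[T]/(Tᵖ) → A` is the same as a ring map `ℤ[T]/(Tᵖ) → A`), for
every commutative ring `A` and `a ∈ A` there is a ring map `ℤ[T]/(Tᵖ) → A` with `T ↦ a` iff `aᵖ = 0` — and it is then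
unique (`ringHom_adjoinRoot_ext`). So the elements `s`, `r'`, `r` of §5 with `sᵖ = 0`, `(r')ᵖ = 0`, `rᵖ = 0` ARE the
objects of `𝒢` over `W_{m,p+1}`, `W_{m,p}[ε]`, `W_{m,p+1}[ε]`.
[cite: Schroeer2003T1LiftingPositiveCharacteristic, Ex. 3.5 (arXiv p0009 L36–39)] -/
theorem exists_ringHom_adjoinRoot_iff {A : Type*} [CommRing A] (p : ℕ) (a : A) :
    (∃ φ : AdjoinRoot ((X : ℤ[X]) ^ p) →+* A, φ (AdjoinRoot.root _) = a) ↔ a ^ p = 0 := by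
  constructor
  · rintro ⟨φ, rfl⟩
    rw [← map_pow, AdjoinRoot.root, ← map_pow, AdjoinRoot.mk_self, map_zero]
  · intro ha
    exact ⟨AdjoinRoot.lift (Int.castRingHom A) a (by rw [eval₂_X_pow, ha]), AdjoinRoot.lift_root _⟩

/-! ### §5 [Sch03, Ex. 3.5], second half: along `W_{m,p+1} → W_{m,p}`, `m = 2p+1`, the T¹-lifting condition FAILS

(Instance synthesis for powers in `W_{m,d}[ε] = DualNumber (W p m d)` — Mathlib's `TrivSqZeroExt` over a quotient of a
subalgebra — exceeds the default budget; the `synthInstance.maxHeartbeats` bumps below are for that only.) -/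

/-- `ε`-part of a power in `R[ε]`, `R` commutative: `(a + bε)ⁿ = aⁿ + n·aⁿ⁻¹b·ε` (Mathlib's `TrivSqZeroExt.snd_pow`
in the form used below; private helper). [folklore] -/
private theorem snd_pow_eq {R : Type*} [CommRing R] (x : DualNumber R) (n : ℕ) :
    (x ^ n).snd = (n : R) * x.fst ^ (n - 1) * x.snd := by
  cases n with
  | zero => rw [pow_zero, TrivSqZeroExt.snd_one, Nat.cast_zero, zero_mul, zero_mul]
  | succ n =>
    induction n with
    | zero => rw [zero_add, pow_one, Nat.cast_one, one_mul, Nat.sub_self, pow_zero, one_mul]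
    | succ n ih =>
      rw [pow_succ, DualNumber.snd_mul, ih, TrivSqZeroExt.fst_pow]
      simp only [Nat.add_sub_cancel]
      push_cast
      ring

section Example

variable (p : ℕ) [hp : Fact p.Prime] (m : ℕ)

omit hp in
/-- «Set `m = 2p+1` … `λ = p² ∈ W_m`, such that `pλᵖ = 0`»: here in `W_{m,d} ⊇ W_m`, `λ = p²`, `pλᵖ = p^{2p+1} = 0`.
[cite: Schroeer2003T1LiftingPositiveCharacteristic, Ex. 3.5 (arXiv p0009 L58–60)] -/
theorem p_mul_lam_pow_eq_zero (hm : m = 2 * p + 1) (d : ℕ) : (p : W p m d) * ((p : W p m d) ^ 2) ^ p = 0 := by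
  rw [← pow_mul, ← pow_succ', show 2 * p + 1 = m from hm.symm, natCast_pow_eq_zero]

omit hp in
/-- `γ⁰(T) = 1`. [cite: Schroeer2003T1LiftingPositiveCharacteristic, §2 (arXiv p0006 L33–37)] -/
theorem gam_zero (d : ℕ) : gam p m d 0 = 1 := by
  rw [gam, ← (Ideal.Quotient.mk (truncIdeal p m d)).map_one]
  congr 1
  exact Subtype.ext (by rw [coe_gamma, OneMemClass.coe_one, Nat.factorial_zero, Nat.cast_one, inv_one, C_1,
    one_mul, pow_zero])

/-- «… and `p²λ^{p−1} ≠ 0`» (`λ = p²`, `m = 2p+1`): `p²·λ^{p−1} = p^{2p} ≠ 0` in `W_{m,d}`, `d ≥ 1`.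
[cite: Schroeer2003T1LiftingPositiveCharacteristic, Ex. 3.5 (arXiv p0009 L58–60)] -/
theorem p_sq_mul_lam_pow_ne_zero (hm : m = 2 * p + 1) {d : ℕ} (hd : 1 ≤ d) :
    (p : W p m d) ^ 2 * ((p : W p m d) ^ 2) ^ (p - 1) ≠ 0 := by
  have hp1 := hp.out.one_lt
  intro h
  rw [← pow_mul, ← pow_add, show 2 + 2 * (p - 1) = 2 * p by omega] at h
  have h1 : ((p : ℤ) ^ (2 * p)) • gam p m d 0 = 0 := by
    rw [gam_zero, zsmul_eq_mul, mul_one, Int.cast_pow, Int.cast_natCast, h]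
  rw [zsmul_gam_eq_zero_iff (by omega)] at h1
  have h2 := Int.le_of_dvd (by positivity) h1
  have h3 : (p : ℤ) ^ (2 * p) < (p : ℤ) ^ (2 * p + 1) := pow_lt_pow_right₀ (by exact_mod_cast hp1) (by omega)
  rw [hm] at h2
  omega

/-- «Then `s = λγ¹(T) ∈ W_{m,p+1}` satisfies `sᵖ = 0`» (`λ = p²`, `m = 2p+1`): `sᵖ = p^{2p}·Tᵖ = p^{2p}·p!·γᵖ(T)`
and `p^{2p+1} ∣ p^{2p}·p!`. [cite: Schroeer2003T1LiftingPositiveCharacteristic, Ex. 3.5 (arXiv p0009 L60–61)] -/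
theorem s_pow_eq_zero (hm : m = 2 * p + 1) : ((p : W p m (p + 1)) ^ 2 * gam p m (p + 1) 1) ^ p = 0 := by
  have hp1 := hp.out.one_lt
  have h1 : ((p : W p m (p + 1)) ^ 2 * gam p m (p + 1) 1) ^ p = ((p : W p m (p + 1)) ^ 2) ^ p * gam p m (p + 1) 1 ^ p :=
    mul_pow ((p : W p m (p + 1)) ^ 2) (gam p m (p + 1) 1) p
  have h2 : ((p : W p m (p + 1)) ^ 2) ^ p * gam p m (p + 1) 1 ^ p =
      (((p : ℤ) ^ (2 * p) * (p.factorial : ℤ) : ℤ)) • gam p m (p + 1) p := by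
    rw [gam_one_pow, zsmul_eq_mul, zsmul_eq_mul]
    push_cast
    ring
  rw [h1, h2, zsmul_gam_eq_zero_iff (Nat.lt_succ_self p), hm]
  obtain ⟨q, hq⟩ : ∃ q, p = q + 1 := ⟨p - 1, by omega⟩
  refine ⟨(q.factorial : ℤ), ?_⟩
  rw [hq, Nat.factorial_succ, ← hq]
  push_cast
  ring

set_option synthInstance.maxHeartbeats 400000 in
/-- «Let `s' ∈ W_{m,p}` be its image. Then the deformation `r' = (λ+ε)γ¹(T) ∈ W_{m,p}[ε]` satisfies `(r')ᵖ = 0`»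
(`r' = λT + T·ε`; in `W_{m,p}` already `Tᵖ = p!γᵖ(T) = 0`).
[cite: Schroeer2003T1LiftingPositiveCharacteristic, Ex. 3.5 (arXiv p0009 L61–64)] -/
theorem rPrime_pow_eq_zero :
    (TrivSqZeroExt.inl ((p : W p m p) ^ 2 * gam p m p 1) + TrivSqZeroExt.inr (gam p m p 1) : DualNumber (W p m p)) ^ p
      = 0 := by
  have hp1 := hp.out.one_lt
  have hT : gam p m p 1 ^ p = 0 := by rw [gam_one_pow, gam_eq_zero_of_le le_rfl]; exact smul_zero _
  have hT' : gam p m p 1 ^ (p - 1) * gam p m p 1 = 0 := by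
    have h : gam p m p 1 ^ (p - 1 + 1) = gam p m p 1 ^ (p - 1) * gam p m p 1 := pow_succ (gam p m p 1) (p - 1)
    rw [← h, Nat.sub_add_cancel hp1.le, hT]
  set x : DualNumber (W p m p) :=
    TrivSqZeroExt.inl ((p : W p m p) ^ 2 * gam p m p 1) + TrivSqZeroExt.inr (gam p m p 1) with hx
  have hxf : x.fst = (p : W p m p) ^ 2 * gam p m p 1 := by
    rw [hx, TrivSqZeroExt.fst_add, TrivSqZeroExt.fst_inl, TrivSqZeroExt.fst_inr, add_zero]
  have hxs : x.snd = gam p m p 1 := by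
    rw [hx, TrivSqZeroExt.snd_add, TrivSqZeroExt.snd_inl, TrivSqZeroExt.snd_inr, zero_add]
  have h1 : (x ^ p).fst = x.fst ^ p := TrivSqZeroExt.fst_pow x p
  have h2 : (x ^ p).snd = (p : W p m p) * x.fst ^ (p - 1) * x.snd := snd_pow_eq x p
  have ha : ((p : W p m p) ^ 2 * gam p m p 1) ^ p = 0 := by
    have h : ((p : W p m p) ^ 2 * gam p m p 1) ^ p = ((p : W p m p) ^ 2) ^ p * gam p m p 1 ^ p :=
      mul_pow ((p : W p m p) ^ 2) (gam p m p 1) p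
    rw [h, hT, mul_zero]
  have ha' : ((p : W p m p) ^ 2 * gam p m p 1) ^ (p - 1) * gam p m p 1 = 0 := by
    have h : ((p : W p m p) ^ 2 * gam p m p 1) ^ (p - 1) = ((p : W p m p) ^ 2) ^ (p - 1) * gam p m p 1 ^ (p - 1) :=
      mul_pow ((p : W p m p) ^ 2) (gam p m p 1) (p - 1)
    rw [h, mul_assoc, hT', mul_zero]
  refine TrivSqZeroExt.ext ?_ ?_
  · rw [h1, hxf, ha, TrivSqZeroExt.fst_zero]
  · rw [h2, hxf, hxs, mul_assoc, ha', mul_zero, TrivSqZeroExt.snd_zero]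

omit hp in
/-- `r'` lies over `s`: the image `s'` of `s` in `W_{m,p}` is `r'` modulo `ε`.
[cite: Schroeer2003T1LiftingPositiveCharacteristic, Ex. 3.5 (arXiv p0009 L61–62)] -/
theorem res_s_eq_fst_rPrime :
    res p m p ((p : W p m (p + 1)) ^ 2 * gam p m (p + 1) 1) =
      (TrivSqZeroExt.inl ((p : W p m p) ^ 2 * gam p m p 1) + TrivSqZeroExt.inr (gam p m p 1) :
        DualNumber (W p m p)).fst := by
  rw [TrivSqZeroExt.fst_add, TrivSqZeroExt.fst_inl, TrivSqZeroExt.fst_inr, add_zero, map_mul, map_pow,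
    map_natCast, res_gam]

/-- The key vanishing in `W_{m,p+1}`: `γ^{p−1}(T)·f = 0` for every `f ∈ (p^m, γ^{≥ p})` — in coordinates
`a_n(γ^{p−1} f) = \binom{n}{p−1} a_{n−p+1}(f)` involves only `a_0(f), a_1(f)` for `n ≤ p`, both divisible by `p^m`
(`p ≥ 2`). This is why the undetermined term `x·γᵖ(T)` of print's lift `r` does not contribute to `rᵖ`.
[cite: Schroeer2003T1LiftingPositiveCharacteristic, Ex. 3.5 (arXiv p0009 L66–76)] -/
theorem gam_pred_mul_eq_zero_of_mem {f : divPowPoly} (hf : f ∈ truncIdeal p m p) :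
    gam p m (p + 1) (p - 1) * Ideal.Quotient.mk (truncIdeal p m (p + 1)) f = 0 := by
  have hp2 := hp.out.two_le
  rw [gam, ← map_mul, Ideal.Quotient.eq_zero_iff_mem, mem_truncIdeal_iff]
  rw [mem_truncIdeal_iff] at hf
  intro n hn
  rw [dpc_mul]
  refine dvd_sum fun ij hij => ?_
  rw [mem_antidiagonal] at hij
  rw [dpc_gamma]
  split_ifs with h
  · exact Dvd.dvd.mul_left (hf ij.2 (by omega)) _
  · rw [mul_zero, zero_mul]; exact dvd_zero _

/-- The kernel of `W_{m,p+1} → W_{m,p}` is `W_m·γᵖ(T)`: an element of `(p^m, γ^{≥ p})` becomes an INTEGER multiple of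
`γᵖ(T)` in `W_{m,p+1}` (print's «`xγᵖ(T)` for some `x ∈ W_m`»).
[cite: Schroeer2003T1LiftingPositiveCharacteristic, Ex. 3.5 (arXiv p0009 L66–68)] -/
theorem exists_mk_eq_zsmul_gam_of_mem (p m : ℕ) {f : divPowPoly} (hf : f ∈ truncIdeal p m p) :
    ∃ x : ℤ, Ideal.Quotient.mk (truncIdeal p m (p + 1)) f = x • gam p m (p + 1) p := by
  refine ⟨dpc f p, ?_⟩
  rw [mem_truncIdeal_iff] at hf
  have hsum : Ideal.Quotient.mk (truncIdeal p m (p + 1)) f = ∑ n ∈ (f : ℚ[X]).support, dpc f n • gam p m (p + 1) n := by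
    conv_lhs => rw [eq_sum_dpc_smul_gamma f]
    rw [map_sum]
    exact sum_congr rfl fun n _ => by rw [map_zsmul, gam]
  rw [hsum, sum_eq_single p]
  · intro n _ hn
    rcases lt_or_gt_of_ne hn with h | h
    · exact (zsmul_gam_eq_zero_iff (Nat.lt_succ_of_lt h) _).2 (hf n h)
    · rw [gam_eq_zero_of_le (Nat.succ_le_of_lt h)]; exact smul_zero _
  · intro h
    rw [Polynomial.notMem_support_iff] at h
    rw [dpc_eq_of_eq f p 0 (by rw [h, mul_zero, Int.cast_zero]), zero_smul]

/-- «We have `r = (λ+ε)γ¹(T) + xγᵖ(T)` for some `x ∈ W_m`»: every `r ∈ W_{m,p+1}[ε]` restricting to `s = λγ¹(T)`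
(under `ε ↦ 0`) and to `r' = (λ+ε)γ¹(T)` (under `W_{m,p+1}[ε] → W_{m,p}[ε]`) has the shape
`r = λγ¹(T) + (γ¹(T) + x·γᵖ(T))·ε`, `x ∈ ℤ` (i.e. `x ∈ W_m = ℤ/p^m`) — print's `xγᵖ(T)` read in the `ε`-component
(restriction to `s` leaves no room for an `ε`-free multiple of `γᵖ(T) ≠ 0`; see HONEST SCOPE (6)). No hypothesis
`rᵖ = 0` here.
[cite: Schroeer2003T1LiftingPositiveCharacteristic, Ex. 3.5 (arXiv p0009 L66–68)] -/
theorem exists_eq_of_restrictions (p m : ℕ) (r : DualNumber (W p m (p + 1)))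
    (hfst : r.fst = (p : W p m (p + 1)) ^ 2 * gam p m (p + 1) 1)
    (hres : dualNumberMap (res p m p) r =
      TrivSqZeroExt.inl ((p : W p m p) ^ 2 * gam p m p 1) + TrivSqZeroExt.inr (gam p m p 1)) :
    ∃ x : ℤ, r = TrivSqZeroExt.inl ((p : W p m (p + 1)) ^ 2 * gam p m (p + 1) 1) +
      TrivSqZeroExt.inr (gam p m (p + 1) 1 + x • gam p m (p + 1) p) := by
  have hsnd : res p m p r.snd = gam p m p 1 := by
    have h := congrArg TrivSqZeroExt.snd hres
    rwa [snd_dualNumberMap, TrivSqZeroExt.snd_add, TrivSqZeroExt.snd_inl, TrivSqZeroExt.snd_inr, zero_add] at h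
  obtain ⟨g, hg⟩ := Ideal.Quotient.mk_surjective r.snd
  have hfmem : g - gamma 1 ∈ truncIdeal p m p := by
    rw [← Ideal.Quotient.eq, ← Ideal.Quotient.factor_mk (truncIdeal_anti p m (Nat.le_succ p)), hg]
    exact hsnd
  obtain ⟨x, hx⟩ := exists_mk_eq_zsmul_gam_of_mem p m hfmem
  refine ⟨x, ?_⟩
  have hb : r.snd = gam p m (p + 1) 1 + x • gam p m (p + 1) p := by
    rw [← hx, map_sub, hg, gam, add_sub_cancel]
  rw [← hb, ← hfst, TrivSqZeroExt.inl_fst_add_inr_snd_eq]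

set_option synthInstance.maxHeartbeats 400000 in
/-- **[Sch03, Ex. 3.5, second half] — «Hence `π : 𝒢 → (Art/W)` does not satisfy the T¹-lifting condition»**, for
`W = ℤ_p` (absolutely unramified, `e = 1`), `m = 2p + 1`, along `W_{m,p+1} → W_{m,p}` ([Schroeer2003T1LiftingPositiveCharacteristic,
Def. 3.2 (ii)] at `(m, d) = (2p+1, p+1)`): with `λ = p²`, `s = λγ¹(T) ∈ W_{m,p+1}` (`sᵖ = 0`: a point of
`A ↦ {a ∈ A | aᵖ = 0}` over `W_{m,p+1}`, `s_pow_eq_zero`) and `r' = (λ + ε)γ¹(T) ∈ W_{m,p}[ε]` (`(r')ᵖ = 0`,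
`rPrime_pow_eq_zero`; over the image `s'` of `s`, `res_s_eq_fst_rPrime`), there is NO `r ∈ W_{m,p+1}[ε]` with `rᵖ = 0`
restricting to `s` under `ε ↦ 0` and to `r'` under `W_{m,p+1}[ε] → W_{m,p}[ε]`. Print: «We have
`r = (λ+ε)γ¹(T) + xγᵖ(T)` for some `x ∈ W_m` and calculate `0 = rᵖ = p²λ^{p−1}(p−1)!·εγᵖ(T) ≠ 0`, a contradiction.»
Typed: such an `r` is `λT + ε(T + c)` with `c` in the image of `(p^m, γ^{≥p})`; the `ε`-part of `rᵖ` is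
`p(λT)^{p−1}(T + c) = pλ^{p−1}Tᵖ` (`gam_pred_mul_eq_zero_of_mem` kills `c`) `= p^{2p−1}·p!·γᵖ(T) = p^{2p}(p−1)!·γᵖ(T)`,
nonzero in `W_{m,p+1}` because `p ∤ (p−1)!`. So `T¹(X/W_{m,p+1}) → T¹(X'/W_{m,p})` misses `r'`.
[cite: Schroeer2003T1LiftingPositiveCharacteristic, Ex. 3.5 (arXiv p0009 L51–78) and Def. 3.2 (ii)] -/
theorem not_exists_lift (hm : m = 2 * p + 1) :
    ¬ ∃ r : DualNumber (W p m (p + 1)),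
      r ^ p = 0 ∧ r.fst = (p : W p m (p + 1)) ^ 2 * gam p m (p + 1) 1 ∧
        dualNumberMap (res p m p) r =
          TrivSqZeroExt.inl ((p : W p m p) ^ 2 * gam p m p 1) + TrivSqZeroExt.inr (gam p m p 1) := by
  have hp1 := hp.out.one_lt
  have hp2 := hp.out.two_le
  rintro ⟨r, hrp, hfst, hres⟩
  -- the `ε`-part `b` of `r` restricts to `T = γ¹(T)` in `W_{m,p}`
  have hsnd : res p m p r.snd = gam p m p 1 := by
    have h := congrArg TrivSqZeroExt.snd hres
    rwa [snd_dualNumberMap, TrivSqZeroExt.snd_add, TrivSqZeroExt.snd_inl, TrivSqZeroExt.snd_inr, zero_add] at h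
  -- so `b = T + c` with `c` the class of some element of `(p^m, γ^{≥ p})`
  obtain ⟨g, hg⟩ := Ideal.Quotient.mk_surjective r.snd
  have hfmem : g - gamma 1 ∈ truncIdeal p m p := by
    rw [← Ideal.Quotient.eq, ← Ideal.Quotient.factor_mk (truncIdeal_anti p m (Nat.le_succ p)), hg]
    exact hsnd
  have hb : r.snd = gam p m (p + 1) 1 + Ideal.Quotient.mk (truncIdeal p m (p + 1)) (g - gamma 1) := by
    rw [map_sub, hg, gam, add_sub_cancel]
  -- the `ε`-part of `rᵖ = 0`: `p · a^{p-1} · b = 0` with `a = λT`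
  have h2 : (r ^ p).snd = (p : W p m (p + 1)) * r.fst ^ (p - 1) * r.snd := snd_pow_eq r p
  have hε : (p : W p m (p + 1)) * r.fst ^ (p - 1) * r.snd = 0 := by rw [← h2, hrp, TrivSqZeroExt.snd_zero]
  rw [hfst, hb, mul_add] at hε
  -- `(λT)^{p-1} = λ^{p-1}·T^{p-1} = λ^{p-1}(p-1)!·γ^{p-1}(T)`
  have hpow : ((p : W p m (p + 1)) ^ 2 * gam p m (p + 1) 1) ^ (p - 1) =
      ((p : W p m (p + 1)) ^ 2) ^ (p - 1) * gam p m (p + 1) 1 ^ (p - 1) :=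
    mul_pow ((p : W p m (p + 1)) ^ 2) (gam p m (p + 1) 1) (p - 1)
  -- the correction dies: `p·(λT)^{p-1}·c = 0`
  have hkill : (p : W p m (p + 1)) * ((p : W p m (p + 1)) ^ 2 * gam p m (p + 1) 1) ^ (p - 1) *
      Ideal.Quotient.mk (truncIdeal p m (p + 1)) (g - gamma 1) = 0 := by
    have hz : ((p - 1).factorial : ℤ) • (0 : W p m (p + 1)) = 0 := smul_zero _
    rw [hpow, gam_one_pow, mul_assoc, mul_assoc, smul_mul_assoc, gam_pred_mul_eq_zero_of_mem p m hfmem, hz, mul_zero,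
      mul_zero]
  -- the main term: `p·(λT)^{p-1}·T = p·λ^{p-1}·Tᵖ = p^{2p-1}·p!·γᵖ(T)`
  have hT : gam p m (p + 1) 1 ^ (p - 1) * gam p m (p + 1) 1 = (p.factorial : ℤ) • gam p m (p + 1) p := by
    have h : gam p m (p + 1) 1 ^ (p - 1 + 1) = gam p m (p + 1) 1 ^ (p - 1) * gam p m (p + 1) 1 :=
      pow_succ (gam p m (p + 1) 1) (p - 1)
    rw [← h, Nat.sub_add_cancel hp1.le, gam_one_pow]
  have hmain : (p : W p m (p + 1)) * ((p : W p m (p + 1)) ^ 2 * gam p m (p + 1) 1) ^ (p - 1) * gam p m (p + 1) 1 =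
      (((p : ℤ) ^ (2 * (p - 1) + 1) * (p.factorial : ℤ) : ℤ)) • gam p m (p + 1) p := by
    rw [hpow, mul_assoc, mul_assoc, hT, zsmul_eq_mul, zsmul_eq_mul]
    push_cast
    ring
  rw [hkill, add_zero, hmain, zsmul_gam_eq_zero_iff (Nat.lt_succ_self p), hm] at hε
  -- `p^{2p+1} ∣ p^{2p-1}·p!` would force `p ∣ (p-1)!`
  obtain ⟨q, hq⟩ : ∃ q, p = q + 1 := ⟨p - 1, by omega⟩
  have hfac : (p.factorial : ℤ) = p * (q.factorial : ℤ) := by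
    rw [hq, Nat.factorial_succ]; push_cast; ring
  rw [hfac, ← mul_assoc, ← pow_succ, show 2 * (p - 1) + 1 + 1 = 2 * p by omega, pow_succ] at hε
  have hp0 : (p : ℤ) ^ (2 * p) ≠ 0 := pow_ne_zero _ (by exact_mod_cast hp.out.ne_zero)
  have hdvd : (p : ℤ) ∣ (q.factorial : ℤ) := (mul_dvd_mul_iff_left hp0).1 hε
  have hdvd' : p ∣ q.factorial := by exact_mod_cast hdvd
  have hle := (Nat.Prime.dvd_factorial hp.out).1 hdvd'
  omega

end Example

end Schroeer2003

end Literature.AlgebraicGeometry.Deformation
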